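import Summits.RiemannHypothesis.RiemannHypothesis.Theorems.GroundBartaGroundBartaFloorLeakageEnvelope
import Summits.RiemannHypothesis.RiemannHypothesis.Theorems.GroundBartaGroundBartaFloorHarmonicSplit
import Summits.RiemannHypothesis.RiemannHypothesis.Theorems.GroundBartaGroundBartaFloorLeakageSign
import Summits.RiemannHypothesis.RiemannHypothesis.Theorems.WeilGroundStateGroundStatesConvergeToXiStubStrongClassPairing
import Summits.RiemannHypothesis.RiemannHypothesis.Theorems.WeilGroundStateGroundStatesConvergeToXiStubHarmonicExtension
import Summits.RiemannHypothesis.RiemannHypothesis.Theorems.WeilGroundStateGroundStatesConvergeToXiExpClassHarmonic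
import Literature.NumberTheory.LFunctions.WeilOddThetaVector
import Literature.NumberTheory.LFunctions.WeilThetaPhiMellin
import Literature.NumberTheory.LFunctions.RiemannXi
import HarnessLib

/-!
# Crux `GroundBarta.GroundBartaFloor` (stmt-RiemannHypothesis-18389), line `inner-cutoff-strong-EL`:
stub 3 (`stub_groundHarmonicSplit`) — `W(w ⋆ (Φθ)~) = -W(w ⋆ (Φ(1-θ))~)` for weighted-`L¹` `w`

For `w` integrable vanishing off `(-a, a)` (hence weighted-`L¹` for every exponential weight) and a
smooth cut-off `θ` vanishing for `|t| ≥ a`, both pairings `F₁ = w ⋆ Φ̃` and `F₂ = w ⋆ κ̃`,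
`κ = Φ(1 - θ)`, lie in the strong exponential Weil class (`stub_strongClass_pairing`; the kernels'
envelopes are prover A's `leakEnv_phi_envelope` / `stub_leakageKernelEnvelope`), `W` is additive on
the class (`weilFunctional_sub_expClass`, prover A), and `F₁` is WEIL-HARMONIC for EVERY weighted-`L¹`
`w` (not only for tests): by the class explicit formula `W(F₁) = Σ'_ρ m(ρ) F̂₁(ρ)` with
`F̂₁(ρ) = ŵ(ρ) · conj Φ̂(1 - conj ρ) = ŵ(ρ) · conj ξ(1 - conj ρ) = 0` (`Φ̂ = ξ`,
`weilMellin_weilThetaPhi`; `ξ(1 - s̄) = conj ξ(s)` vanishes with `ξ(ρ)`).  Hence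
`W(w ⋆ (Φθ)~) = W(F₁ - F₂) = 0 - W(F₂)`.  RH-free; Mathlib + proved tree files only.
-/

set_option linter.dupNamespace false

noncomputable section

open Set MeasureTheory Filter Complex
open scoped Real Topology ComplexConjugate

namespace Summit.RiemannHypothesis.RiemannHypothesis.Theorems.GroundBartaFloor

open Literature.NumberTheory.LFunctions
open Summit.RiemannHypothesis.RiemannHypothesis.Theorems.GroundStatesConvergeToXi

/-- **Riemann's kernel is Weil-harmonic against every weighted-`L¹` function**: if `v` is
a.e.-strongly measurable with `∫ ‖v‖ e^{|t|} < ∞`, then `W(v ⋆ Φ̃) = 0` (`Φ̂ = ξ` vanishes at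
`1 - conj ρ` for every non-trivial zero `ρ`; class explicit formula). -/
theorem ic_weilFunctional_weilConv_phi_eq_zero {v : ℝ → ℂ} (hv : AEStronglyMeasurable v volume)
    (hvw : Integrable (fun t : ℝ => ‖v t‖ * Real.exp (1 * |t|))) :
    weilFunctional (weilConv v (weilReflect fun t : ℝ => ((weilThetaPhi t : ℝ) : ℂ))) = 0 := by
  set Φc : ℝ → ℂ := fun t : ℝ => ((weilThetaPhi t : ℝ) : ℂ) with hΦc
  have hΦeq : Φc = fun t : ℝ => (2 : ℂ) * LagariasMontague.Psic (2 * t) :=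
    funext fun t => leakEnv_ofReal_weilThetaPhi t
  have hΦd : ContDiff ℝ (⊤ : ℕ∞) Φc := by rw [hΦeq]; exact contDiff_phi
  have hΦb : ∀ k : ℕ, ∃ C : ℝ, ∀ t : ℝ, ‖iteratedDeriv k Φc t‖ ≤ C * Real.exp (-(1 * |t|)) := by
    intro k
    obtain ⟨C, -, hC⟩ := leakEnv_phi_envelope k
    exact ⟨C, fun t => by rw [hΦeq]; exact hC t⟩
  obtain ⟨hFcd, hFb, hmel⟩ := stub_strongClass_pairing v Φc 1 1 hv (by norm_num) hvw hΦd
    (by norm_num) le_rfl hΦb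
  obtain ⟨C, hF0, hF1, hF2⟩ := hExt_deriv_bounds_of_all hFb
  obtain ⟨-, hsum⟩ := explicit_formula_expClass' _ C 1 hFcd (by norm_num) hF0 hF1 hF2
  rw [← hsum]
  refine (tsum_congr fun ρ => ?_).trans tsum_zero
  have h0 := ZetaZeros.riemannZetaNontrivialZeros.re_pos ρ.2
  have h1 := ZetaZeros.riemannZetaNontrivialZeros.re_lt_one ρ.2
  rw [hmel ρ h0.le h1.le]
  have hξ : weilMellin Φc (1 - conj (ρ : ℂ)) = 0 := by
    rw [hΦc, weilMellin_weilThetaPhi, riemannXi_one_sub, riemannXi_conj_holds,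
      riemannXi_eq_zero_of_mem_riemannZetaNontrivialZeros ρ.2, map_zero]
  rw [hξ, map_zero, mul_zero, mul_zero]

/-- Convolution against a difference of bounded continuous kernels splits, for integrable `v`. -/
theorem ic_weilConv_weilReflect_sub {v A B : ℝ → ℂ} (hvi : Integrable v) (hA : Continuous A)
    (hB : Continuous B) {MA MB : ℝ} (hMA : ∀ x, ‖A x‖ ≤ MA) (hMB : ∀ x, ‖B x‖ ≤ MB) (t : ℝ) :
    weilConv v (weilReflect fun x => A x - B x) t =
      weilConv v (weilReflect A) t - weilConv v (weilReflect B) t := by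
  rw [weilConv_apply, weilConv_apply, weilConv_apply]
  have hiA : Integrable fun u => v u * weilReflect A (t - u) := by
    refine hvi.mul_bdd (c := MA) ?_ (ae_of_all _ fun u => ?_)
    · exact (((hA.comp continuous_neg).star).comp (continuous_const.sub continuous_id)).aestronglyMeasurable
    · simp only [weilReflect, Complex.norm_conj]; exact hMA _
  have hiB : Integrable fun u => v u * weilReflect B (t - u) := by
    refine hvi.mul_bdd (c := MB) ?_ (ae_of_all _ fun u => ?_)
    · exact (((hB.comp continuous_neg).star).comp (continuous_const.sub continuous_id)).aestronglyMeasurable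
    · simp only [weilReflect, Complex.norm_conj]; exact hMB _
  rw [← integral_sub hiA hiB]
  refine integral_congr_ae (ae_of_all _ fun u => ?_)
  simp only [weilReflect, map_sub]
  ring

/-- **Stub 3 of line `inner-cutoff-strong-EL` — the harmonic split.**  For `w ≥ 0` integrable,
vanishing off `(-a, a)`, and a smooth cut-off `θ` vanishing for `|t| ≥ a` with `0 ≤ θ ≤ 1`:
`W(w ⋆ (Φθ)~) = -W(w ⋆ (Φ(1-θ))~)`. -/
theorem stub_groundHarmonicSplit {a : ℝ} {w θ : ℝ → ℝ} (hw : Measurable w) (hw0 : ∀ t, 0 ≤ w t)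
    (hws : ∀ t, t ∉ Ioo (-a) a → w t = 0) (hwi : Integrable w) (hθ : ContDiff ℝ (⊤ : ℕ∞) θ)
    (hθ0 : ∀ t, a ≤ |t| → θ t = 0) (hθ01 : ∀ t, 0 ≤ θ t ∧ θ t ≤ 1) :
    weilFunctional (weilConv (fun t => ((w t : ℝ) : ℂ))
      (weilReflect fun t => ((weilThetaPhi t * θ t : ℝ) : ℂ))) =
    -weilFunctional (weilConv (fun t => ((w t : ℝ) : ℂ))
      (weilReflect fun t => ((weilThetaPhi t * (1 - θ t) : ℝ) : ℂ))) := by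
  have _ := hw
  have _ := hw0
  set vc : ℝ → ℂ := fun t => ((w t : ℝ) : ℂ) with hvc
  set Φc : ℝ → ℂ := fun t : ℝ => ((weilThetaPhi t : ℝ) : ℂ) with hΦc
  set κ : ℝ → ℂ := fun t : ℝ => ((weilThetaPhi t * (1 - θ t) : ℝ) : ℂ) with hκ
  -- class data
  have hθs : HasCompactSupport θ := by
    refine HasCompactSupport.of_support_subset_isCompact (isCompact_Icc (a := -a) (b := a))
      fun t ht => ?_
    by_contra h
    apply ht
    apply hθ0
    simp only [mem_Icc, not_and_or, not_le] at h
    rcases h with h | h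
    · exact le_of_lt (by linarith [neg_abs_le t])
    · exact le_of_lt (h.trans_le (le_abs_self t))
  obtain ⟨hκd, hκb⟩ := stub_leakageKernelEnvelope θ hθ hθs
  have hΦeq : Φc = fun t : ℝ => (2 : ℂ) * LagariasMontague.Psic (2 * t) :=
    funext fun t => leakEnv_ofReal_weilThetaPhi t
  have hΦd : ContDiff ℝ (⊤ : ℕ∞) Φc := by rw [hΦeq]; exact contDiff_phi
  have hΦb : ∀ k : ℕ, ∃ C : ℝ, ∀ t : ℝ, ‖iteratedDeriv k Φc t‖ ≤ C * Real.exp (-(1 * |t|)) := by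
    intro k
    obtain ⟨C, -, hC⟩ := leakEnv_phi_envelope k
    exact ⟨C, fun t => by rw [hΦeq]; exact hC t⟩
  have hva : AEStronglyMeasurable vc volume := hwi.ofReal.aestronglyMeasurable
  have hvw : Integrable (fun t : ℝ => ‖vc t‖ * Real.exp (1 * |t|)) := by
    refine (hwi.norm.mul_const (Real.exp (1 * |a|))).mono' (hva.norm.mul (by fun_prop))
      (ae_of_all _ fun t => ?_)
    rw [Real.norm_eq_abs, abs_of_nonneg (by positivity), hvc]
    dsimp only
    rw [Complex.norm_real]
    by_cases ht : t ∈ Ioo (-a) a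
    · refine mul_le_mul_of_nonneg_left (Real.exp_le_exp.2 ?_) (norm_nonneg _)
      have h1 : |t| ≤ |a| := (abs_lt.2 ⟨ht.1, ht.2⟩).le.trans (le_abs_self a)
      linarith
    · rw [hws t ht]; simp
  obtain ⟨hF1cd, hF1b, -⟩ := stub_strongClass_pairing vc Φc 1 1 hva (by norm_num) hvw hΦd
    (by norm_num) le_rfl hΦb
  obtain ⟨hF2cd, hF2b, -⟩ := stub_strongClass_pairing vc κ 1 1 hva (by norm_num) hvw hκd
    (by norm_num) le_rfl hκb
  -- `w ⋆ (Φθ)~ = w ⋆ Φ̃ - w ⋆ κ̃`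
  obtain ⟨CΦ, -, hCΦ⟩ := leakSign_phi_le_exp
  have hMA : ∀ x, ‖Φc x‖ ≤ CΦ := fun x => by
    rw [hΦc]; dsimp only
    rw [Complex.norm_real, Real.norm_eq_abs, abs_of_pos (weilThetaPhi_pos x)]
    refine (hCΦ x).trans ?_
    have hC0 : 0 ≤ CΦ := le_trans (weilThetaPhi_pos 0).le ((hCΦ 0).trans (by simp))
    exact mul_le_of_le_one_right hC0 (Real.exp_le_one_iff.2 (by nlinarith [abs_nonneg x]))
  have hMB : ∀ x, ‖κ x‖ ≤ CΦ := fun x => by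
    rw [hκ]; dsimp only
    rw [Complex.norm_real, Real.norm_eq_abs, abs_of_nonneg (leakKer_nonneg hθ01 x)]
    refine (leakKer_le hθ01 x).trans ?_
    have h := hMA x
    rw [hΦc] at h; dsimp only at h
    rwa [Complex.norm_real, Real.norm_eq_abs, abs_of_pos (weilThetaPhi_pos x)] at h
  have hprobe : (fun t => ((weilThetaPhi t * θ t : ℝ) : ℂ)) = fun x => Φc x - κ x := by
    funext x
    simp only [hΦc, hκ]
    push_cast
    ring
  have hsplitF : weilConv vc (weilReflect fun t => ((weilThetaPhi t * θ t : ℝ) : ℂ)) =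
      fun t => weilConv vc (weilReflect Φc) t - weilConv vc (weilReflect κ) t := by
    funext t
    rw [hprobe]
    exact ic_weilConv_weilReflect_sub hwi.ofReal hΦd.continuous hκd.continuous hMA hMB t
  rw [hsplitF, weilFunctional_sub_expClass hF1cd hF2cd (by norm_num : (1 : ℝ) / 2 < 1) hF1b hF2b,
    ic_weilFunctional_weilConv_phi_eq_zero hva hvw, zero_sub]

end Summit.RiemannHypothesis.RiemannHypothesis.Theorems.GroundBartaFloor

end
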